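import Summits.AnomalousDissipation.AnomalousDissipation.Theorems.KolmogorovFloor.Negative.CheapBaseTools
import Summits.AnomalousDissipation.AnomalousDissipation.Theorems.KolmogorovFloor.Negative.SlopeBeat
import Summits.AnomalousDissipation.AnomalousDissipation.Theorems.KolmogorovFloor.Negative.TwoModes

/-!
# The band-limited floor fails at every CHEAP BASE STATE (negative side of `KolmogorovFloor`, stmt-14030)

cdisprove seat `refuter-cdisprove-stmt-AnomalousDissipation-14030-0` (2026-08-16). KERNEL OF THE KILL,
per viscosity and after the certificate `(N, Φ₁, θ₁)` is revealed (`cheap_base_kill`): let `a` be a smooth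
solenoidal mean-zero field with enstrophy `≤ E_a`, resolved slope `Σ_{|k|≤N} |k|‖â(k)‖ ≤ S_a`, work
`|(a,f)| ≤ P_a`, and steady-Euler DEFECT `|((a·∇)a − f, W)| ≤ η · max_k |k|‖Ŵ(k)‖` against every band-limited
solenoidal `W`. If `(1+2Θ)·4νE_a + 2ΘP_a ≤ ε₀/4`, `den := 4π²νS_a + η` satisfies `den · Π ≤ ε₀/3` with the
Kolmogorov price `Π := 32π²(1+2Θ)ν(4N+1)²` and `5·den ≤ 1`, and `2∫‖a‖² + 8 ≤ 16‖f‖²/ν²`, then the FLOOR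
inequality cannot hold at the three finite-enstrophy states `a`, `a + w`, `a − w` of the Leray ball, where `w` is
the slope-harvesting axis beat (`axis_beat_data_slope`) of amplitude `√(5·den)` at the heaviest resolved slope
coefficient of `W := Φ₁'(a)`. Mechanism: at `a` the generator pairing is `−((a·∇)a − f, W) + ν(a, ΔW) ≤ den·M_W`
(antisymmetry of `b`, drift bound), so FLOOR(a) forces `den·M_W ≥ 3ε₀/4`; the `±w` symmetrisation of the two
dressed floors isolates the beat `−(9/10)·5den·M_W` against the price `Π·5den ≤ (4/9)M_W·5den`. No frequency
separation between base and waves is needed. Consumers: smooth quiet Euler points (η = 0: every β < 1;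
`Negative/QuietPointKill.lean`), dressed laminar rays and CHEAP states (DRESSED-RAY-r1-3.md Thm A, card
`cheap-steady-euler-closure`: β = 3/4 with η = o(ν^{1/2})).
-/

noncomputable section

open MeasureTheory UnitAddTorus Matrix
open scoped InnerProductSpace ENNReal ComplexConjugate

namespace Summit.AnomalousDissipation.AnomalousDissipation.Theorems.KolmogorovFloor.Negative

open Literature.Analysis.FunctionSpaces Literature.Analysis.FluidPDE
open Summit.AnomalousDissipation.AnomalousDissipation.Theorems.TaylorCertificatePair.Negative


/-- A two-mode sum with negated polarisations is the negated field. -/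
theorem modes_pair_neg (p p' : Fin 3 → ℤ) (zA zB : EuclideanSpace ℂ (Fin 3)) (x : (UnitAddTorus (Fin 3))) :
    (∑ mm, Torus.realTrigPoly {![p, p'] mm} (fun _ => ![-zA, -zB] mm)) x =
      -((∑ mm, Torus.realTrigPoly {![p, p'] mm} (fun _ => ![zA, zB] mm)) x) := by
  rw [modes_apply, modes_apply, Fin.sum_univ_two, Fin.sum_univ_two]
  simp only [Matrix.cons_val_zero, Matrix.cons_val_one, mode_apply, smul_neg, map_neg]
  abel

/-- `2θX ≤ 2Θ·P` when `−Θ ≤ θ ≤ 0` and `|X| ≤ P`. -/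
theorem two_theta_mul_le {θ Θ X P : ℝ} (hθ : -Θ ≤ θ) (hθ' : θ ≤ 0) (hX : |X| ≤ P) : 2 * θ * X ≤ 2 * Θ * P := by
  have h1 : 2 * θ * X ≤ |2 * θ * X| := le_abs_self _
  have h2 : |2 * θ * X| = 2 * |θ| * |X| := by rw [abs_mul, abs_mul, abs_two]
  have h3 : |θ| ≤ Θ := abs_le.2 ⟨by linarith, by linarith⟩
  have h4 : 2 * |θ| * |X| ≤ 2 * Θ * P :=
    mul_le_mul (mul_le_mul_of_nonneg_left h3 zero_le_two) hX (abs_nonneg _) (by linarith [abs_nonneg θ])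
  linarith

set_option maxHeartbeats 400000 in
/-- **The band-limited floor fails at a cheap base state** (see the module docstring). -/
theorem cheap_base_kill
    {f : (UnitAddTorus (Fin 3)) → (EuclideanSpace ℝ (Fin 3))} (hf : Torus.IsSmooth f) {ν : ℝ} (hν : 0 < ν)
    (Φ : Torus.CylindricalTest (Fin 3)) {N : ℕ} (hΦ : ∀ i, Torus.fourierTruncate N (Φ.g i) = Φ.g i)
    {θ Θ ε₀ : ℝ} (hθ : -Θ ≤ θ) (hθ' : θ ≤ 0) (hε₀ : 0 < ε₀)
    {a : (UnitAddTorus (Fin 3)) → (EuclideanSpace ℝ (Fin 3))} (ha : Torus.IsSmooth a) (had : Torus.IsDivFree a) (haz : Torus.HasZeroMean a)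
    {Ea Sa Pa η : ℝ} (hEa : (Torus.eGradNormSq a).toReal ≤ Ea)
    (hSa : ∑ κ ∈ Torus.freqBall N, Real.sqrt (Torus.freqNormSq κ) * ‖mFourierCoeff (EuclideanSpace.complexify ∘ a) κ‖ ≤ Sa)
    (hSa0 : 0 ≤ Sa) (hPa : |∫ x, ⟪a x, f x⟫_ℝ| ≤ Pa) (hη : 0 ≤ η)
    (hdef : ∀ (W : (UnitAddTorus (Fin 3)) → (EuclideanSpace ℝ (Fin 3))) (M : ℝ), Torus.IsSmooth W → Torus.IsDivFree W → Torus.HasZeroMean W →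
      (∀ κ, (N : ℝ) ^ 2 < Torus.freqNormSq κ → mFourierCoeff (EuclideanSpace.complexify ∘ W) κ = 0) →
      (∀ κ, Real.sqrt (Torus.freqNormSq κ) * ‖mFourierCoeff (EuclideanSpace.complexify ∘ W) κ‖ ≤ M) →
      |∫ x, ⟪Torus.convect a a x - f x, W x⟫_ℝ| ≤ η * M)
    (h1 : (1 + 2 * Θ) * (ν * (4 * Ea)) + 2 * Θ * Pa ≤ ε₀ / 4)
    (h2 : (4 * Real.pi ^ 2 * ν * Sa + η) * (32 * Real.pi ^ 2 * (1 + 2 * Θ) * ν * (((4 * N + 1 : ℕ)) : ℝ) ^ 2) ≤ ε₀ / 3)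
    (h3 : 5 * (4 * Real.pi ^ 2 * ν * Sa + η) ≤ 1)
    (hball : 2 * (∫ x, ‖a x‖ ^ 2) + 8 ≤ 16 * (∫ x, ‖f x‖ ^ 2) / ν ^ 2)
    (hu : ∀ u : Torus.energySpace (Fin 3),
      Torus.eGradNormSq ((u : (Lp (EuclideanSpace ℝ (Fin 3)) 2 (volume : Measure (UnitAddTorus (Fin 3))))) : (UnitAddTorus (Fin 3)) → (EuclideanSpace ℝ (Fin 3))) ≠ ⊤ → ‖u‖ ^ 2 ≤ 16 * (∫ x, ‖f x‖ ^ 2) / ν ^ 2 →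
        ε₀ ≤ ν * (Torus.eGradNormSq ((u : (Lp (EuclideanSpace ℝ (Fin 3)) 2 (volume : Measure (UnitAddTorus (Fin 3))))) : (UnitAddTorus (Fin 3)) → (EuclideanSpace ℝ (Fin 3)))).toReal + Torus.nsGeneratorPairing ν f u (Φ.grad u) +
          2 * θ * (Torus.pairing (u : (Lp (EuclideanSpace ℝ (Fin 3)) 2 (volume : Measure (UnitAddTorus (Fin 3))))) f - ν * (Torus.eGradNormSq ((u : (Lp (EuclideanSpace ℝ (Fin 3)) 2 (volume : Measure (UnitAddTorus (Fin 3))))) : (UnitAddTorus (Fin 3)) → (EuclideanSpace ℝ (Fin 3)))).toReal)) :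
    False := by
  have hΘ : 0 ≤ Θ := by linarith only [hθ, hθ']
  have hE0 : 0 ≤ (Torus.eGradNormSq a).toReal := ENNReal.toReal_nonneg
  have hEa0 : 0 ≤ Ea := hE0.trans hEa
  have hPa0 : 0 ≤ Pa := (abs_nonneg _).trans hPa
  have hA0 : 0 ≤ ∫ x, ‖a x‖ ^ 2 := integral_nonneg fun x => by positivity
  have hballa : ∫ x, ‖a x‖ ^ 2 ≤ 16 * (∫ x, ‖f x‖ ^ 2) / ν ^ 2 := by linarith only [hball, hA0]
  /- the base state and its multiplier -/
  obtain ⟨ua, hua⟩ := Summit.AnomalousDissipation.AnomalousDissipation.Theorems.FloorCertificate.Negative.exists_state_of_smooth ha had haz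
  obtain ⟨W, hWdef⟩ : ∃ W : (UnitAddTorus (Fin 3)) → (EuclideanSpace ℝ (Fin 3)), W = Φ.grad ua := ⟨_, rfl⟩
  have hW : Torus.IsSmooth W := by rw [hWdef]; exact isSmooth_grad Φ ua
  have hWd : Torus.IsDivFree W := by rw [hWdef]; exact isDivFree_grad Φ ua
  have hWz : Torus.HasZeroMean W := by rw [hWdef]; exact hasZeroMean_grad Φ ua
  have hband : ∀ κ, (N : ℝ) ^ 2 < Torus.freqNormSq κ → mFourierCoeff (EuclideanSpace.complexify ∘ W) κ = 0 := by
    rw [hWdef]; exact fc_grad_eq_zero Φ hΦ ua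
  /- the heaviest resolved slope coefficient -/
  obtain ⟨q, hqmem, hqmax⟩ := Finset.exists_max_image (Torus.freqBall (d := Fin 3) N)
    (fun κ => Real.sqrt (Torus.freqNormSq κ) * ‖(mFourierCoeff (EuclideanSpace.complexify ∘ W) κ)‖) ⟨0, Torus.zero_mem_freqBall N⟩
  obtain ⟨g, hgdef⟩ : ∃ g : EuclideanSpace ℂ (Fin 3), g = mFourierCoeff (EuclideanSpace.complexify ∘ W) q := ⟨_, rfl⟩
  obtain ⟨M, hMdef⟩ : ∃ M : ℝ, M = Real.sqrt (Torus.freqNormSq q) * ‖g‖ := ⟨_, rfl⟩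
  have hM0 : 0 ≤ M := by rw [hMdef]; positivity
  have hM : ∀ κ, Real.sqrt (Torus.freqNormSq κ) * ‖mFourierCoeff (EuclideanSpace.complexify ∘ W) κ‖ ≤ M := by
    intro κ
    by_cases hκ : Torus.freqNormSq κ ≤ (N : ℝ) ^ 2
    · rw [hMdef, hgdef]; exact hqmax κ (Torus.mem_freqBall.2 hκ)
    · rw [hband κ (lt_of_not_ge hκ), norm_zero, mul_zero]; exact hM0
  /- the floor at the base -/
  have hfl0 := floor_on_rep (F2 := 16 * (∫ x, ‖f x‖ ^ 2) / ν ^ 2) ha hua hWdef.symm hballa (hu ua)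
  have hI : ∫ x, ⟪Torus.fderiv W x (a x), a x⟫_ℝ = -∫ x, ⟪W x, Torus.convect a a x⟫_ℝ := by
    have h := Torus.integral_inner_convect_eq_neg ha had hW ha
    exact h
  have hsplit : ∫ x, ⟪Torus.convect a a x - f x, W x⟫_ℝ = (∫ x, ⟪W x, Torus.convect a a x⟫_ℝ) - ∫ x, ⟪f x, W x⟫_ℝ := by
    simp_rw [inner_sub_left]
    rw [integral_sub (((ha.convect ha).inner hW).integrable) ((hf.inner hW).integrable)]
    congr 1
    exact integral_congr_ae (ae_of_all _ fun x => real_inner_comm _ _)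
  have hdefW := hdef W M hW hWd hWz hband hM
  have hFI : (∫ x, ⟪f x, W x⟫_ℝ) + ∫ x, ⟪Torus.fderiv W x (a x), a x⟫_ℝ ≤ η * M := by
    rw [hI]
    have h := neg_abs_le (∫ x, ⟪Torus.convect a a x - f x, W x⟫_ℝ)
    rw [hsplit] at h hdefW
    linarith only [h, hdefW]
  have hdrift : ν * (∫ x, ⟪a x, Torus.laplacian W x⟫_ℝ) ≤ ν * (4 * Real.pi ^ 2 * Sa * M) :=
    mul_le_mul_of_nonneg_left (integral_inner_laplacian_le_slope ha hW hband hM0 hM hSa) hν.le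
  have hθP : 2 * θ * (∫ x, ⟪a x, f x⟫_ℝ) ≤ 2 * Θ * Pa := two_theta_mul_le hθ hθ' hPa
  have hEν : ν * (Torus.eGradNormSq a).toReal * (1 - 2 * θ) ≤ ν * Ea * (1 + 2 * Θ) :=
    mul_le_mul (mul_le_mul_of_nonneg_left hEa hν.le) (by linarith only [hθ]) (by linarith only [hθ']) (by positivity)
  have hbase : ε₀ ≤ (1 + 2 * Θ) * (ν * Ea) + 2 * Θ * Pa + (4 * Real.pi ^ 2 * ν * Sa + η) * M := by
    linarith only [hfl0, hFI, hdrift, hθP, hEν]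
  /- `den · M ≥ 3ε₀/4` -/
  obtain ⟨den, hdendef⟩ : ∃ den : ℝ, den = 4 * Real.pi ^ 2 * ν * Sa + η := ⟨_, rfl⟩
  rw [← hdendef] at hbase h2 h3
  have hden0 : 0 ≤ den := by rw [hdendef]; positivity
  have hE1 : (1 + 2 * Θ) * (ν * Ea) + 2 * Θ * Pa ≤ ε₀ / 4 := by
    have : (1 + 2 * Θ) * (ν * Ea) ≤ (1 + 2 * Θ) * (ν * (4 * Ea)) :=
      mul_le_mul_of_nonneg_left (by nlinarith only [hν, hEa0]) (by linarith only [hΘ])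
    linarith only [this, h1]
  have hdenM : 3 * ε₀ / 4 ≤ den * M := by linarith only [hbase, hE1]
  have hMpos : 0 < M := by
    rcases hM0.lt_or_eq with h | h
    · exact h
    · rw [← h, mul_zero] at hdenM; linarith only [hdenM, hε₀]
  have hdenpos : 0 < den := by
    rcases hden0.lt_or_eq with h | h
    · exact h
    · rw [← h, zero_mul] at hdenM; linarith only [hdenM, hε₀]
  have hg0 : g ≠ 0 := by
    intro h
    have : M = 0 := by rw [hMdef, h, norm_zero, mul_zero]
    linarith only [this, hMpos]
  have hq0 : q ≠ 0 := by
    intro h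
    have : M = 0 := by rw [hMdef, h, Torus.freqNormSq_zero, Real.sqrt_zero, zero_mul]
    linarith only [this, hMpos]
  have hqN : Torus.freqNormSq q ≤ (N : ℝ) ^ 2 := Torus.mem_freqBall.1 hqmem
  have hgq : ((fun j => ((q) j : ℂ)) ⬝ᵥ (WithLp.ofLp (g))) = 0 := by rw [hgdef, hWdef]; exact dotc_fc_grad Φ ua q
  /- price and amplitude -/
  obtain ⟨P, hPdef⟩ : ∃ P : ℝ, P = 32 * Real.pi ^ 2 * (1 + 2 * Θ) * ν * (((4 * N + 1 : ℕ)) : ℝ) ^ 2 := ⟨_, rfl⟩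
  rw [← hPdef] at h2
  have hP0 : 0 ≤ P := by rw [hPdef]; positivity
  have hPM : P ≤ 4 / 9 * M := by
    refine le_of_mul_le_mul_left ?_ hdenpos
    linarith only [h2, hdenM]
  obtain ⟨T, hTdef⟩ : ∃ T : ℝ, T = 5 * den := ⟨_, rfl⟩
  have hT0 : 0 ≤ T := by rw [hTdef]; positivity
  have hT1 : T ≤ 1 := by rw [hTdef]; exact h3
  obtain ⟨t, htdef⟩ : ∃ t : ℝ, t = Real.sqrt T := ⟨_, rfl⟩
  have ht0 : 0 ≤ t := by rw [htdef]; exact Real.sqrt_nonneg _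
  have ht2 : t ^ 2 = T := by rw [htdef]; exact Real.sq_sqrt hT0
  have ht1 : t ≤ 1 := by rw [htdef]; exact Real.sqrt_le_one.2 hT1
  /- the slope beat -/
  obtain ⟨p, zA, zB, gain, hNp, hNpq, hN5, hLp, hLpq, -, hdA, hdB, hBq, hzA, hzB, hbeat, hgain⟩ :=
    axis_beat_data_slope hq0 0 hqN g hg0 hgq ht0
  have hgainM : 9 / 10 * t ^ 2 * M ≤ gain := by rw [hMdef]; exact hgain
  have hp0 : p ≠ 0 := ne_zero_of_freqNormSq_pos (sq_nonneg _) hNp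
  have hpq0 : p + q ≠ 0 := ne_zero_of_freqNormSq_pos (sq_nonneg _) hNpq
  have eL : (((4 * N + 1 + 2 * 0 : ℕ)) : ℝ) = (((4 * N + 1 : ℕ)) : ℝ) := by norm_num
  rw [eL] at hLp hLpq
  have hL : ∀ m, Torus.freqNormSq ((![p, p + q] : Fin 2 → (Fin 3 → ℤ)) m) ≤ (((4 * N + 1 : ℕ)) : ℝ) ^ 2 := by
    intro m; fin_cases m
    · exact hLp
    · exact hLpq
  have hk2 : ∀ m, (N : ℝ) ^ 2 < Torus.freqNormSq ((![p, p + q] : Fin 2 → (Fin 3 → ℤ)) m) := by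
    intro m; fin_cases m
    · exact hNp
    · exact hNpq
  /- the wave fields `w` and `w' = -w` -/
  set w : (UnitAddTorus (Fin 3)) → (EuclideanSpace ℝ (Fin 3)) := (∑ mm, Torus.realTrigPoly {(![p, p + q] : Fin 2 → (Fin 3 → ℤ)) mm} (fun _ => (![zA, zB] : Fin 2 → EuclideanSpace ℂ (Fin 3)) mm)) with hwdef
  set w' : (UnitAddTorus (Fin 3)) → (EuclideanSpace ℝ (Fin 3)) := (∑ mm, Torus.realTrigPoly {(![p, p + q] : Fin 2 → (Fin 3 → ℤ)) mm} (fun _ => (![-zA, -zB] : Fin 2 → EuclideanSpace ℂ (Fin 3)) mm)) with hw'def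
  have hw : Torus.IsSmooth w := isSmooth_modes _ _
  have hw' : Torus.IsSmooth w' := isSmooth_modes _ _
  have hdA' : ((fun j => ((p) j : ℂ)) ⬝ᵥ (WithLp.ofLp (-zA))) = 0 := by rw [dotc_neg_right, hdA, neg_zero]
  have hdB' : ((fun j => (((p + q)) j : ℂ)) ⬝ᵥ (WithLp.ofLp (-zB))) = 0 := by rw [dotc_neg_right, hdB, neg_zero]
  have hwd : Torus.IsDivFree w := isDivFree_modes _ _ (fun m => by
    fin_cases m
    · exact hdA
    · exact hdB)
  have hw'd : Torus.IsDivFree w' := isDivFree_modes _ _ (fun m => by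
    fin_cases m
    · exact hdA'
    · exact hdB')
  have hkne : ∀ m, (![p, p + q] : Fin 2 → (Fin 3 → ℤ)) m ≠ 0 := by
    intro m; fin_cases m
    · exact hp0
    · exact hpq0
  have hwz : Torus.HasZeroMean w := hasZeroMean_modes _ _ hkne
  have hw'z : Torus.HasZeroMean w' := hasZeroMean_modes _ _ hkne
  have hneg : ∀ x, w' x = -(w x) := fun x => modes_pair_neg p (p + q) zA zB x
  have hfun1 : a + w' = a - w := funext fun x => by rw [Pi.add_apply, Pi.sub_apply, hneg, sub_eq_add_neg]
  have hfun2 : a + w = a - w' := funext fun x => by rw [Pi.add_apply, Pi.sub_apply, hneg, sub_neg_eq_add]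
  /- the dressed states -/
  obtain ⟨up, hup⟩ := Summit.AnomalousDissipation.AnomalousDissipation.Theorems.FloorCertificate.Negative.exists_state_of_smooth
    (ha.add hw) (Torus.IsDivFree.add (ha.isContDiff (by simp)) (hw.isContDiff (by simp)) had hwd)
    (Torus.HasZeroMean.add haz hwz ha.integrable hw.integrable)
  obtain ⟨um, hum⟩ := Summit.AnomalousDissipation.AnomalousDissipation.Theorems.FloorCertificate.Negative.exists_state_of_smooth
    (ha.add hw') (Torus.IsDivFree.add (ha.isContDiff (by simp)) (hw'.isContDiff (by simp)) had hw'd)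
    (Torus.HasZeroMean.add haz hw'z ha.integrable hw'.integrable)
  have hgrad_p : Φ.grad up = W := by rw [hWdef]; exact grad_eq_of_coords_eq Φ (coords_add_modes_eq Φ hΦ hk2 ha hua hup)
  have hgrad_m : Φ.grad um = W := by rw [hWdef]; exact grad_eq_of_coords_eq Φ (coords_add_modes_eq Φ hΦ hk2 ha hua hum)
  /- the Leray ball -/
  have hsum2 : ∑ m, ‖(![zA, zB] : Fin 2 → EuclideanSpace ℂ (Fin 3)) m‖ ≤ t + t := by
    simp only [Fin.sum_univ_two, Matrix.cons_val_zero, Matrix.cons_val_one]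
    linarith only [hzA, hzB]
  have hsum2' : ∑ m, ‖(![-zA, -zB] : Fin 2 → EuclideanSpace ℂ (Fin 3)) m‖ ≤ t + t := by
    simp only [Fin.sum_univ_two, Matrix.cons_val_zero, Matrix.cons_val_one, norm_neg]
    linarith only [hzA, hzB]
  have hsum0 : 0 ≤ ∑ m, ‖(![zA, zB] : Fin 2 → EuclideanSpace ℂ (Fin 3)) m‖ := Finset.sum_nonneg fun m _ => norm_nonneg _
  have hsum0' : 0 ≤ ∑ m, ‖(![-zA, -zB] : Fin 2 → EuclideanSpace ℂ (Fin 3)) m‖ := Finset.sum_nonneg fun m _ => norm_nonneg _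
  have htt : (t + t) ^ 2 ≤ 4 * T := by rw [← ht2]; nlinarith only [ht0]
  have hT4 : 4 * T ≤ 4 := by linarith only [hT1]
  have hwL2 : ∫ x, ‖w x‖ ^ 2 ≤ 4 * T :=
    (integral_norm_sq_modes_le.trans (pow_le_pow_left₀ hsum0 hsum2 2)).trans htt
  have hw'L2 : ∫ x, ‖w' x‖ ^ 2 ≤ 4 * T :=
    (integral_norm_sq_modes_le.trans (pow_le_pow_left₀ hsum0' hsum2' 2)).trans htt
  have hballp : ∫ x, ‖(a + w) x‖ ^ 2 ≤ 16 * (∫ x, ‖f x‖ ^ 2) / ν ^ 2 := by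
    have h := integral_norm_sq_add_le ha hw
    linarith only [h, hwL2, hT4, hball]
  have hballm : ∫ x, ‖(a + w') x‖ ^ 2 ≤ 16 * (∫ x, ‖f x‖ ^ 2) / ν ^ 2 := by
    have h := integral_norm_sq_add_le ha hw'
    linarith only [h, hw'L2, hT4, hball]
  /- the two dressed floors -/
  have hflp := floor_on_rep (F2 := 16 * (∫ x, ‖f x‖ ^ 2) / ν ^ 2) (ha.add hw) hup hgrad_p hballp (hu up)
  have hflm := floor_on_rep (F2 := 16 * (∫ x, ‖f x‖ ^ 2) / ν ^ 2) (ha.add hw') hum hgrad_m hballm (hu um)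
  rw [hfun1] at hflm
  /- symmetrisation -/
  have hIsum := inertial_pair_sum ha hw hW
  have hLsum := integral_inner_pair_sum ha hw hW.laplacian
  have hPsum := integral_inner_pair_sum ha hw hf
  /- the wave's own inertial term is the beat -/
  have hN5' : (N : ℝ) ^ 2 < Torus.freqNormSq ((p + q) + p) := by
    rw [show (p + q) + p = p + (p + q) by abel]; exact hN5
  have hIw : ∫ x, ⟪Torus.fderiv W x (w x), w x⟫_ℝ =
      Real.pi * (conj (((fun j => ((q) j : ℂ)) ⬝ᵥ (WithLp.ofLp (zA)))) * ⟪(mFourierCoeff (EuclideanSpace.complexify ∘ W) q), zB⟫_ℂ).im :=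
    inertial_two hW p q zA zB hdA hdB hBq (hband _ hN5) (hband _ hN5')
  rw [← hgdef] at hIw
  /- enstrophies -/
  have hEw : (Torus.eGradNormSq w).toReal ≤ 4 * Real.pi ^ 2 * (((4 * N + 1 : ℕ)) : ℝ) ^ 2 * (4 * T) :=
    (toReal_eGradNormSq_modes_le hL).trans (mul_le_mul_of_nonneg_left hwL2 (by positivity))
  have hEw' : (Torus.eGradNormSq w').toReal ≤ 4 * Real.pi ^ 2 * (((4 * N + 1 : ℕ)) : ℝ) ^ 2 * (4 * T) :=
    (toReal_eGradNormSq_modes_le hL).trans (mul_le_mul_of_nonneg_left hw'L2 (by positivity))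
  have hfinA : Torus.eGradNormSq a ≠ ⊤ :=
    Summit.AnomalousDissipation.AnomalousDissipation.Theorems.FloorCertificate.Negative.eGradNormSq_ne_top_of_smooth ha
  have hfinw : Torus.eGradNormSq w ≠ ⊤ := eGradNormSq_modes_ne_top
  have hfinw' : Torus.eGradNormSq w' ≠ ⊤ := eGradNormSq_modes_ne_top
  have hEsub : ∀ {v : (UnitAddTorus (Fin 3)) → (EuclideanSpace ℝ (Fin 3))}, Torus.IsSmooth v → Torus.eGradNormSq v ≠ ⊤ →
      (Torus.eGradNormSq (a - v)).toReal ≤ 2 * (Torus.eGradNormSq a).toReal + 2 * (Torus.eGradNormSq v).toReal := by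
    intro v hv hfinv
    have h1 := Literature.Analysis.FluidPDE.Torus.eGradNormSq_sub_le ha.integrable hv.integrable
    have hfin : 2 * Torus.eGradNormSq a + 2 * Torus.eGradNormSq v ≠ ⊤ :=
      ENNReal.add_ne_top.2 ⟨ENNReal.mul_ne_top (by simp) hfinA, ENNReal.mul_ne_top (by simp) hfinv⟩
    have h2 := ENNReal.toReal_mono hfin h1
    rw [ENNReal.toReal_add (ENNReal.mul_ne_top (by simp) hfinA) (ENNReal.mul_ne_top (by simp) hfinv),
      ENNReal.toReal_mul, ENNReal.toReal_mul] at h2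
    simpa only [ENNReal.toReal_ofNat] using h2
  have hEm : (Torus.eGradNormSq (a - w)).toReal ≤ 2 * (Torus.eGradNormSq a).toReal + 2 * (Torus.eGradNormSq w).toReal :=
    hEsub hw hfinw
  have hEp : (Torus.eGradNormSq (a + w)).toReal ≤ 2 * (Torus.eGradNormSq a).toReal + 2 * (Torus.eGradNormSq w').toReal := by
    rw [hfun2]; exact hEsub hw' hfinw'
  have hEp0 : 0 ≤ (Torus.eGradNormSq (a + w)).toReal := ENNReal.toReal_nonneg
  have hEm0 : 0 ≤ (Torus.eGradNormSq (a - w)).toReal := ENNReal.toReal_nonneg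
  -- `ν E (1 − 2θ) ≤ ν (1 + 2Θ) · bound`
  have hEνp : ν * (Torus.eGradNormSq (a + w)).toReal * (1 - 2 * θ) ≤
      ν * (2 * Ea + 2 * (4 * Real.pi ^ 2 * (((4 * N + 1 : ℕ)) : ℝ) ^ 2 * (4 * T))) * (1 + 2 * Θ) :=
    mul_le_mul (mul_le_mul_of_nonneg_left (by linarith only [hEp, hEa, hEw']) hν.le)
      (by linarith only [hθ]) (by linarith only [hθ']) (by positivity)
  have hEνm : ν * (Torus.eGradNormSq (a - w)).toReal * (1 - 2 * θ) ≤
      ν * (2 * Ea + 2 * (4 * Real.pi ^ 2 * (((4 * N + 1 : ℕ)) : ℝ) ^ 2 * (4 * T))) * (1 + 2 * Θ) :=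
    mul_le_mul (mul_le_mul_of_nonneg_left (by linarith only [hEm, hEa, hEw]) hν.le)
      (by linarith only [hθ]) (by linarith only [hθ']) (by positivity)
  /- the endgame -/
  have hbeatT : Real.pi * (conj (((fun j => ((q) j : ℂ)) ⬝ᵥ (WithLp.ofLp (zA)))) * ⟪g, zB⟫_ℂ).im ≤ -(9 / 10 * T * M) := by
    rw [← ht2]; linarith only [hbeat, hgainM]
  have hPT : ν * (2 * (4 * Real.pi ^ 2 * (((4 * N + 1 : ℕ)) : ℝ) ^ 2 * (4 * T))) * (1 + 2 * Θ) = P * T := by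
    rw [hPdef]; ring
  -- the linear-in-`w` sums, pre-multiplied
  have hLsumν : ν * (∫ x, ⟪(a + w) x, Torus.laplacian W x⟫_ℝ) + ν * (∫ x, ⟪(a - w) x, Torus.laplacian W x⟫_ℝ) =
      ν * (2 * ∫ x, ⟪a x, Torus.laplacian W x⟫_ℝ) := by rw [← hLsum]; ring
  have hPsumθ : 2 * θ * (∫ x, ⟪(a + w) x, f x⟫_ℝ) + 2 * θ * (∫ x, ⟪(a - w) x, f x⟫_ℝ) =
      2 * θ * (2 * ∫ x, ⟪a x, f x⟫_ℝ) := by rw [← hPsum]; ring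
  -- sum of the two dressed floors
  have hsum : 2 * ε₀ ≤ 2 * ((1 + 2 * Θ) * (ν * (2 * Ea)) + 2 * Θ * Pa + den * M) + 2 * (P * T) - 2 * (9 / 10 * T * M) := by
    rw [hdendef]
    linarith only [hflp, hflm, hIsum, hLsumν, hPsumθ, hIw, hbeatT, hEνp, hEνm, hFI, hdrift, hθP, hPT]
  have hfinal : ε₀ ≤ ε₀ / 4 + den * M + P * T - 9 / 10 * T * M := by
    have : (1 + 2 * Θ) * (ν * (2 * Ea)) + 2 * Θ * Pa ≤ ε₀ / 4 := by
      have : (1 + 2 * Θ) * (ν * (2 * Ea)) ≤ (1 + 2 * Θ) * (ν * (4 * Ea)) :=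
        mul_le_mul_of_nonneg_left (by nlinarith only [hν, hEa0]) (by linarith only [hΘ])
      linarith only [this, h1]
    linarith only [hsum, this]
  -- `P ≤ (4/9) M`, `T = 5 den`, `den M ≥ 3ε₀/4`
  have hA : P * T ≤ 4 / 9 * M * T := mul_le_mul_of_nonneg_right hPM hT0
  rw [hTdef] at hfinal hA
  linarith only [hfinal, hA, hdenM, hε₀]

end Summit.AnomalousDissipation.AnomalousDissipation.Theorems.KolmogorovFloor.Negative
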